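import Literature.NumberTheory.EllipticCurves.TateCurve.TateFormalIdentity
import Literature.NumberTheory.EllipticCurves.TateCurve.Discriminant
import Mathlib.AlgebraicGeometry.EllipticCurve.Affine.Point
import HarnessLib

/-!
# Tate's map `φ : Kˣ → E_q(K)`, `u ↦ (X(u,q), Y(u,q))`, `q^ℤ ↦ O`
# (Silverman, *Advanced Topics*, Thm. V.3.1 (c))

Topic `Literature/NumberTheory/EllipticCurves/TateCurve`, namespace
`Literature.NumberTheory.EllipticCurves.TateCurve` (abc-iut cell, TRANCHE-T1 P21; the point map of
the discharge plan of the named fact `uniformization`; interface for the homomorphism / kernel /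
surjectivity steps, the latter taken by L2-t6).

For a complete ultrametric field `K` of characteristic `0`, `q ∈ K` with `0 < ‖q‖ < 1` (so that
`E_q = tateCurve q` is an elliptic curve, `tateCurve_isElliptic`) and `u ∈ Kˣ`:

* `tatePoint_equation` : for `u ∉ q^ℤ`, `(X(u,q), Y(u,q))` satisfies the Weierstrass equation of
  `E_q : y² + xy = x³ + a₄(q)x + a₆(q)` (`tate_onCurve`, `TateFormalIdentity`), hence is a
  nonsingular point (`tatePoint_nonsingular`, `E_q` being elliptic);
* `tatePoint q u : (tateCurve q)⟮K⟯` — Silverman's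
  `φ(u) = (X(u,q), Y(u,q))` if `u ∉ q^ℤ`, `φ(u) = O` if `u ∈ q^ℤ` (PDF p. 395);
* `tatePoint_of_mem_zpowers`, `tatePoint_of_not_mem`, `tatePoint_mul_q` (`φ(qu) = φ(u)`).

## References
* [SilvermanATAEC1994] J. H. Silverman, *Advanced Topics in the Arithmetic of Elliptic Curves*,
  GTM 151, Springer 1994, Thm. V.3.1 (c) (PDF p. 395).
-/

noncomputable section

open scoped Classical

namespace Literature.NumberTheory.EllipticCurves.TateCurve

open SteinWuthrich2013 WeierstrassCurve

universe u

variable {K : Type u} [NontriviallyNormedField K] [CompleteSpace K] [IsUltrametricDist K]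
  [CharZero K] {q : K}

omit [CompleteSpace K] [IsUltrametricDist K] in
/-- `12 ≠ 0` in a field of characteristic `0`. [folklore] -/
private theorem twelve_ne_zero' : (12 : K) ≠ 0 := by norm_num

omit [IsUltrametricDist K] in
/-- For `u ∉ q^ℤ`, `(X(u,q), Y(u,q))` satisfies the equation of `E_q` (`tate_onCurve` in Mathlib's
`WeierstrassCurve.Affine.Equation` form). [cite: SilvermanATAEC1994, Thm. V.3.1 (c) (PDF pp. 395–397)] -/
theorem tatePoint_equation (hq0 : q ≠ 0) (hq : ‖q‖ < 1) (u : Kˣ) (hu : ∀ n : ℤ, (u : K) ≠ q ^ n) :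
    (tateCurve q).toAffine.Equation (tateX q (u : K)) (tateY q (u : K)) := by
  rw [WeierstrassCurve.Affine.equation_iff]
  have h := tate_onCurve hq0 hq twelve_ne_zero' u hu
  simp only [tateCurve]
  linear_combination h

/-- For `u ∉ q^ℤ`, `(X(u,q), Y(u,q))` is a nonsingular point of the elliptic curve `E_q`.
[cite: SilvermanATAEC1994, Thm. V.3.1 (c) (PDF pp. 395–397)] -/
theorem tatePoint_nonsingular (hq0 : q ≠ 0) (hq : ‖q‖ < 1) (u : Kˣ)
    (hu : ∀ n : ℤ, (u : K) ≠ q ^ n) :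
    (tateCurve q).toAffine.Nonsingular (tateX q (u : K)) (tateY q (u : K)) := by
  haveI := tateCurve_isElliptic hq0 hq
  exact WeierstrassCurve.Affine.equation_iff_nonsingular.mp (tatePoint_equation hq0 hq u hu)

/-- **Tate's map `φ : Kˣ → E_q(K)`**: `φ(u) = (X(u,q), Y(u,q))` for `u ∉ q^ℤ` and `φ(u) = O` for
`u ∈ q^ℤ` (Silverman ATAEC V.3.1 (c), PDF p. 395); for `q = 0` or `‖q‖ ≥ 1` the junk value `O`.
[cite: SilvermanATAEC1994, Thm. V.3.1 (c) (PDF p. 395)] -/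
def tatePoint (q : K) (u : Kˣ) : (tateCurve q).toAffine.Point :=
  if h : q ≠ 0 ∧ ‖q‖ < 1 ∧ ∀ n : ℤ, (u : K) ≠ q ^ n then
    .some _ _ (tatePoint_nonsingular h.1 h.2.1 u h.2.2)
  else 0

/-- `φ(u) = O` for `u = qⁿ`. [cite: SilvermanATAEC1994, Thm. V.3.1 (c) (PDF p. 395)] -/
theorem tatePoint_of_eq_zpow (u : Kˣ) {n : ℤ} (hu : (u : K) = q ^ n) : tatePoint q u = 0 := by
  rw [tatePoint, dif_neg]
  intro h
  exact h.2.2 n hu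

/-- `φ(u) = (X(u,q), Y(u,q))` for `u ∉ q^ℤ` (`0 < ‖q‖ < 1`). [cite: SilvermanATAEC1994, Thm. V.3.1 (c) (PDF p. 395)] -/
theorem tatePoint_of_ne_zpow (hq0 : q ≠ 0) (hq : ‖q‖ < 1) (u : Kˣ) (hu : ∀ n : ℤ, (u : K) ≠ q ^ n) :
    tatePoint q u = .some _ _ (tatePoint_nonsingular hq0 hq u hu) := by
  rw [tatePoint, dif_pos ⟨hq0, hq, hu⟩]

/-- `φ(u) = O ↔ u ∈ q^ℤ` (`0 < ‖q‖ < 1`). [cite: SilvermanATAEC1994, Thm. V.3.1 (c) (PDF p. 395)] -/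
theorem tatePoint_eq_zero_iff (hq0 : q ≠ 0) (hq : ‖q‖ < 1) (u : Kˣ) :
    tatePoint q u = 0 ↔ ∃ n : ℤ, (u : K) = q ^ n := by
  constructor
  · intro h
    by_contra hne
    push Not at hne
    rw [tatePoint_of_ne_zpow hq0 hq u hne] at h
    exact WeierstrassCurve.Affine.Point.some_ne_zero _ h
  · rintro ⟨n, hn⟩
    exact tatePoint_of_eq_zpow u hn

/-- `φ(qu) = φ(u)` (`X(qu) = X(u)`, `Y(qu) = Y(u)`, and `qu ∈ q^ℤ ↔ u ∈ q^ℤ`).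
[cite: SilvermanATAEC1994, Thm. V.3.1 (c) (PDF pp. 395–396)] -/
theorem tatePoint_mul_q (hq0 : q ≠ 0) (hq : ‖q‖ < 1) (u : Kˣ) :
    tatePoint q (Units.mk0 q hq0 * u) = tatePoint q u := by
  by_cases hu : ∀ n : ℤ, (u : K) ≠ q ^ n
  · have hu' : ∀ n : ℤ, ((Units.mk0 q hq0 * u : Kˣ) : K) ≠ q ^ n := by
      intro n h
      apply hu (n - 1)
      rw [Units.val_mul, Units.val_mk0] at h
      rw [zpow_sub_one₀ hq0, ← h, mul_assoc, mul_comm (u : K), ← mul_assoc, mul_inv_cancel₀ hq0,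
        one_mul]
    rw [tatePoint_of_ne_zpow hq0 hq u hu, tatePoint_of_ne_zpow hq0 hq _ hu']
    simp only [Units.val_mul, Units.val_mk0, tateX_mul_left hq0, tateY_mul_left hq0]
  · push Not at hu
    obtain ⟨n, hn⟩ := hu
    rw [tatePoint_of_eq_zpow u hn, tatePoint_of_eq_zpow (n := n + 1)]
    rw [Units.val_mul, Units.val_mk0, hn, zpow_add_one₀ hq0, mul_comm]

end Literature.NumberTheory.EllipticCurves.TateCurve

end
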